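import Mathlib
import Summits.AtomisticToContinuum.Crystallization.Theses.SquareWellLayerCake
import Literature.Geometry.DiscreteGeometry.DelaunaySubdivision
import Literature.Geometry.DiscreteGeometry.SolidAngleFraction
import Summits.AtomisticToContinuum.Crystallization.Theorems.SquareWellLayerCakeAveragedTwelveAssemble
import Summits.AtomisticToContinuum.Crystallization.Theorems.SquareWellLayerCakeAveragedTwelveVertexFlat
import Summits.AtomisticToContinuum.Crystallization.Theorems.SquareWellLayerCakeAveragedTwelveEdgeFlat
import Summits.AtomisticToContinuum.Crystallization.Theorems.SquareWellLayerCakeAveragedTwelveGirardCell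
import Summits.AtomisticToContinuum.Crystallization.Theorems.SquareWellLayerCakeAveragedTwelveTetGauge
import HarnessLib

/-!
# Line `Sketch` (par-five-delaunay-recount), crux `SquareWellLayerCake.AveragedTwelve`
# (stmt-AtomisticToContinuum-15806): THE CONVERSE — the crux implies the open stub `stub_cellChargeSep`

With the landed `stub_assembleSep ∘ stub_gaugeSep ∘ stub_tetGauge` (cell charge ≤ 0 ⟹ crux) this file closes the
circle: `AveragedTwelve ⟹ (total cell charge ≤ 0 on separated far frames)`.  Hence the one open stub of the line
is PROVABLY EQUIVALENT to the crux — it is exactly crux-sized, neither weaker nor stronger.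
Proof: for an admissible `(ω, P, K)` the landed identities give
`Σ_cells charge = Σ_{p∈P} Σ_{z∈Nb p} (t_pz − 5 − [far]) = Σ_{p∈P} (#{q ∈ P : q ≠ p, |pq| ≤ ρ} − 12)`
(`residual_eq_sum_close`: tetrahedron gauge + Euler link recount + Gabriel near pairs), and the last sum is
`≤ 0` by the crux applied to an enumeration `Fin #P ≃ P` of the point set.
-/

noncomputable section

open scoped BigOperators Classical

namespace Summit.AtomisticToContinuum.Crystallization.Theorems.ParFiveRecountConverse

open Literature.Geometry.DiscreteGeometry
open Summit.AtomisticToContinuum.Crystallization.Theorems.ParFiveRecountAssemble (recount_comb near_pair_mem_faces)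

/-- **The residual counts ρ-close points.** On a separated far frame, for any Delaunay triangulation and the
neighbour / cell finsets `Nb`, `S`, the recounted excess at the real vertices equals
`Σ_{p∈P} (#{q ∈ P : q ≠ p, |pq| ≤ ρ} − 12)`. [folklore] -/
theorem residual_eq_sum_close {d ρ : ℝ} (hd : 0 < d) (hρ : ρ ≤ 57 / 50 * d)
    (ω P : Finset (EuclideanSpace ℝ (Fin 3))) (hPω : P ⊆ ω)
    (hωsep : ∀ a ∈ ω, ∀ b ∈ ω, a ≠ b → d ≤ dist a b)
    (hghost : ∀ g ∈ ω, g ∉ P → ∀ p ∈ P, ∀ q ∈ P, dist p q + ρ < dist g p)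
    (hPint : (↑P : Set (EuclideanSpace ℝ (Fin 3))) ⊆ interior (convexHull ℝ (↑ω : Set (EuclideanSpace ℝ (Fin 3)))))
    (K : Geometry.SimplicialComplex ℝ (EuclideanSpace ℝ (Fin 3)))
    (hK : IsDelaunayTriangulation (↑ω : Set (EuclideanSpace ℝ (Fin 3))) K)
    (Nb : EuclideanSpace ℝ (Fin 3) → Finset (EuclideanSpace ℝ (Fin 3)))
    (hNb : ∀ p ∈ P, ∀ z, z ∈ Nb p ↔ z ≠ p ∧ ({p, z} : Finset (EuclideanSpace ℝ (Fin 3))) ∈ K.faces)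
    (S : EuclideanSpace ℝ (Fin 3) → EuclideanSpace ℝ (Fin 3) → Finset (Finset (EuclideanSpace ℝ (Fin 3))))
    (hS : ∀ p ∈ P, ∀ z ∈ Nb p, ∀ t, t ∈ S p z ↔ t ∈ K.faces ∧ p ∈ t ∧ z ∈ t ∧ t.card = 4) :
    ∑ p ∈ P, ∑ z ∈ Nb p, (((S p z).card : ℤ) - 5 - if ρ < dist p z then 1 else 0)
      = ∑ p ∈ P, (((P.filter fun q => q ≠ p ∧ dist p q ≤ ρ).card : ℤ) - 12) := by
  have hghostP : ∀ g ∈ ω, g ∉ P → ∀ p ∈ P, ρ < dist g p ∧ d ≤ dist g p := by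
    intro g hg hgP p hp
    refine ⟨?_, hωsep g hg p (hPω hp) (fun h => hgP (h ▸ hp))⟩
    have := hghost g hg hgP p hp p hp
    rw [dist_self] at this; linarith
  have hfin : K.faces.Finite := hK.finite_faces ω.finite_toSet
  -- recount at each p ∈ P
  have hrec : ∀ p ∈ P, ((Nb p).card : ℤ) - 12 = ∑ z ∈ Nb p, (((S p z).card : ℤ) - 5) := by
    intro p hp
    have hpω : p ∈ ω := hPω hp
    have hpint : p ∈ interior (convexHull ℝ (↑ω : Set (EuclideanSpace ℝ (Fin 3)))) :=
      hPint (Finset.mem_coe.2 hp)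
    set Sv : Finset (Finset (EuclideanSpace ℝ (Fin 3))) :=
      hfin.toFinset.filter fun t => p ∈ t ∧ t.card = 4 with hSvdef
    have hSv : ∀ t, t ∈ Sv ↔ t ∈ K.faces ∧ p ∈ t ∧ t.card = 4 := by
      intro t; simp only [hSvdef, Finset.mem_filter, Set.Finite.mem_toFinset]
    have hfilt : ∀ z ∈ Nb p, Sv.filter (fun t => z ∈ t) = S p z := by
      intro z hz; ext t; simp only [Finset.mem_filter, hSv, hS p hp z hz]; tauto
    have key := recount_comb Sv (Nb p) p
      (fun t => ballFraction p (apexCone p (fun w : ↥(t.erase p) => (↑w : EuclideanSpace ℝ (Fin 3)) - p)))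
      (fun t z => ballFraction p (apexWedge p (z - p)
        (fun w : ↥((t.erase p).erase z) => (↑w : EuclideanSpace ℝ (Fin 3)) - p)))
      (fun t ht => ⟨((hSv t).1 ht).2.1, ((hSv t).1 ht).2.2⟩)
      (by
        intro t ht z hzt hzp
        rw [hNb p hp]
        refine ⟨hzp, K.down_closed ((hSv t).1 ht).1 ?_ (Finset.insert_nonempty _ _)⟩
        intro w hw
        rcases Finset.mem_insert.1 hw with rfl | hw
        · exact ((hSv t).1 ht).2.1
        · rw [Finset.mem_singleton.1 hw]; exact hzt)
      (by rw [hNb p hp]; exact fun h => h.1 rfl)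
      (ParFiveRecountVertexFlat.stub_vertexFlat ω K hK.toIsTriangulation p hpω hpint Sv hSv)
      (by
        intro z hz
        have hz' := (hNb p hp z).1 hz
        refine ParFiveRecountEdgeFlat.stub_edgeFlat ω K hK.toIsTriangulation p hpω hpint z hz'.1 hz'.2
          (Sv.filter fun t => z ∈ t) ?_
        intro t; simp only [Finset.mem_filter, hSv]; tauto)
      (fun t ht => ParFiveRecountGirardCell.stub_girardCell K t ((hSv t).1 ht).1 ((hSv t).1 ht).2.2 p
        ((hSv t).1 ht).2.1)
    rw [key]
    exact Finset.sum_congr rfl fun z hz => by rw [hfilt z hz]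
  -- near neighbours in K = ρ-close points of P
  have hnear : ∀ p ∈ P, (Nb p).filter (fun z => ¬ ρ < dist p z) =
      P.filter (fun q => q ≠ p ∧ dist p q ≤ ρ) := by
    intro p hp
    ext z
    simp only [Finset.mem_filter, not_lt]
    constructor
    · rintro ⟨hz, hzρ⟩
      have hz' := (hNb p hp z).1 hz
      have hzω : z ∈ ω := Finset.mem_coe.1 (hK.mem_of_mem hz'.2 (by simp))
      have hzP : z ∈ P := by
        by_contra hzP
        have := (hghostP z hzω hzP p hp).1
        rw [dist_comm] at this
        linarith
      exact ⟨hzP, hz'.1, hzρ⟩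
    · rintro ⟨hzP, hzp, hzρ⟩
      refine ⟨(hNb p hp z).2 ⟨hzp, ?_⟩, hzρ⟩
      have hρ0 : 0 ≤ ρ := dist_nonneg.trans hzρ
      refine near_pair_mem_faces hK hd.le (Finset.mem_coe.2 (hPω hp)) (Finset.mem_coe.2 (hPω hzP))
        (Ne.symm hzp) ?_ ?_
      · have h1 : dist p z ^ 2 ≤ ρ ^ 2 := pow_le_pow_left₀ dist_nonneg hzρ 2
        have h2 : ρ ^ 2 ≤ (57 / 50 * d) ^ 2 := pow_le_pow_left₀ hρ0 hρ 2
        nlinarith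
      · intro x hx hxp hxz
        have hxω : x ∈ ω := Finset.mem_coe.1 hx
        exact ⟨hωsep x hxω p (hPω hp) hxp, hωsep x hxω z (hPω hzP) hxz⟩
  refine Finset.sum_congr rfl fun p hp => ?_
  rw [Finset.sum_sub_distrib, ← hrec p hp, ← hnear p hp, Finset.sum_ite, Finset.sum_const_zero,
    add_zero, Finset.sum_const, nsmul_eq_mul, mul_one]
  have hc := Finset.card_filter_add_card_filter_not (s := Nb p) (fun z => ρ < dist p z)
  have hc' : (((Nb p).filter (fun z => ¬ ρ < dist p z)).card : ℤ) =
      (Nb p).card - ((Nb p).filter (fun z => ρ < dist p z)).card := by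
    rw [← hc]; push_cast; ring
  rw [hc']
  ring

/-- **The crux bounds the close-pair count of a finite point set** (its own statement, read on an enumeration
`Fin #P ≃ P`). [folklore] -/
theorem sum_close_le_of_crux (hA : Summit.AtomisticToContinuum.Crystallization.Theses.SquareWellLayerCake.AveragedTwelve) {d ρ : ℝ} (hd : 0 < d) (hρ : ρ ≤ 57 / 50 * d)
    (P : Finset (EuclideanSpace ℝ (Fin 3))) (hsep : ∀ p ∈ P, ∀ q ∈ P, p ≠ q → d ≤ dist p q) :
    ∑ p ∈ P, (((P.filter fun q => q ≠ p ∧ dist p q ≤ ρ).card : ℤ) - 12) ≤ 0 := by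
  -- enumerate P
  set n := P.card with hn
  let e : Fin n ≃ ↥P := P.equivFin.symm
  let x : Fin n → EuclideanSpace ℝ (Fin 3) := fun i => (e i : EuclideanSpace ℝ (Fin 3))
  have hxinj : Function.Injective x := fun i j h => e.injective (Subtype.ext h)
  have hxmem : ∀ i, x i ∈ P := fun i => (e i).2
  have hsepx : ∀ i ∈ (Finset.univ : Finset (Fin n)), ∀ j ∈ (Finset.univ : Finset (Fin n)), i ≠ j →
      d ≤ dist (x i) (x j) :=
    fun i _ j _ hij => hsep _ (hxmem i) _ (hxmem j) (fun h => hij (hxinj h))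
  have h := hA n x Finset.univ d ρ hd hρ hsepx
  rw [Finset.card_univ, Fintype.card_fin] at h
  -- translate the Fin-indexed counts to counts over P
  have hcount : ∀ i : Fin n, ((Finset.univ.filter fun j : Fin n => j ≠ i ∧ dist (x i) (x j) ≤ ρ).card) =
      (P.filter fun q => q ≠ x i ∧ dist (x i) q ≤ ρ).card := by
    intro i
    refine Finset.card_bij (fun j _ => x j) (fun j hj => ?_) (fun j₁ _ j₂ _ h => hxinj h) (fun q hq => ?_)
    · rw [Finset.mem_filter] at hj ⊢
      exact ⟨hxmem j, fun h => hj.2.1 (hxinj h), hj.2.2⟩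
    · rw [Finset.mem_filter] at hq
      refine ⟨e.symm ⟨q, hq.1⟩, ?_, ?_⟩
      · rw [Finset.mem_filter]
        have hxq : x (e.symm ⟨q, hq.1⟩) = q := by
          show ((e (e.symm ⟨q, hq.1⟩) : ↥P) : EuclideanSpace ℝ (Fin 3)) = q
          rw [Equiv.apply_symm_apply]
        refine ⟨Finset.mem_univ _, fun h => hq.2.1 ?_, by rw [hxq]; exact hq.2.2⟩
        rw [← hxq, h]
      · show ((e (e.symm ⟨q, hq.1⟩) : ↥P) : EuclideanSpace ℝ (Fin 3)) = q
        rw [Equiv.apply_symm_apply]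
  have hsumeq : (∑ i : Fin n, ((Finset.univ.filter fun j : Fin n => j ≠ i ∧ dist (x i) (x j) ≤ ρ).card : ℝ)) =
      ∑ p ∈ P, ((P.filter fun q => q ≠ p ∧ dist p q ≤ ρ).card : ℝ) := by
    rw [Finset.sum_congr rfl fun i _ => by rw [hcount i]]
    exact Finset.sum_equiv (e.trans (Equiv.subtypeEquivRight (fun _ => Iff.rfl))) (fun i => by simp)
      (fun i _ => rfl) |>.trans (Finset.sum_coe_sort P (fun p => ((P.filter fun q => q ≠ p ∧ dist p q ≤ ρ).card : ℝ)))
  rw [hsumeq] at h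
  have hZ : ((∑ p ∈ P, (((P.filter fun q => q ≠ p ∧ dist p q ≤ ρ).card : ℤ) - 12) : ℤ) : ℝ) ≤ 0 := by
    push_cast
    rw [Finset.sum_sub_distrib, Finset.sum_const, nsmul_eq_mul]
    linarith
  exact_mod_cast hZ

/-- **The crux implies the open stub** (registered stub `stub_cellChargeSep_of_crux`): total cell charge `≤ 0` on
every separated far frame.  With the landed `stub_assembleSep`, `stub_gaugeSep`, `stub_tetGauge` the open stub
`stub_cellChargeSep` of line `Sketch` is therefore EQUIVALENT to `AveragedTwelve`. -/
theorem stub_cellChargeSep_of_crux : Summit.AtomisticToContinuum.Crystallization.Theses.SquareWellLayerCake.AveragedTwelve → ∀ (d ρ : ℝ), 0 < d → ρ ≤ 57 / 50 * d → ∀ (ω P : Finset (EuclideanSpace ℝ (Fin 3))), P ⊆ ω → (∀ a ∈ ω, ∀ b ∈ ω, a ≠ b → d ≤ dist a b) → (∀ g ∈ ω, g ∉ P → ∀ p ∈ P, ∀ q ∈ P, dist p q + ρ < dist g p) → (↑P : Set (EuclideanSpace ℝ (Fin 3))) ⊆ interior (convexHull ℝ (↑ω : Set (EuclideanSpace ℝ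 (Fin 3)))) → ∀ (K : Geometry.SimplicialComplex ℝ (EuclideanSpace ℝ (Fin 3))), Literature.Geometry.DiscreteGeometry.IsDelaunayTriangulation (↑ω : Set (EuclideanSpace ℝ (Fin 3))) K → ∀ (Cells : Finset (Finset (EuclideanSpace ℝ (Fin 3)))), (∀ t, t ∈ Cells ↔ t ∈ K.faces ∧ t.card = 4) → ∑ t ∈ Cells, ∑ p ∈ P.filter (fun p => p ∈ t), (3 - ∑ z ∈ (t).erase p, (if ρ < dist p z then (6 : ℝ) else 5) * Literature.Geometry.DiscreteGeometry.ballFraction p (Literature.Geometry.DiscreteGeometry.apexWedge p (z - p) (fun w : ↥(((t).erase p).erase z) => (↑w : EuclideanSpace ℝ (Fin 3)) - p))) ≤ 0 := by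
  intro hA d ρ hd hρ ω P hPω hωsep hghost hPint K hK Cells hCells
  have hfin : K.faces.Finite := hK.finite_faces ω.finite_toSet
  set Nb : EuclideanSpace ℝ (Fin 3) → Finset (EuclideanSpace ℝ (Fin 3)) := fun p =>
    ω.filter fun z => z ≠ p ∧ ({p, z} : Finset (EuclideanSpace ℝ (Fin 3))) ∈ K.faces with hNbdef
  have hNb : ∀ p ∈ P, ∀ z, z ∈ Nb p ↔
      z ≠ p ∧ ({p, z} : Finset (EuclideanSpace ℝ (Fin 3))) ∈ K.faces := by
    intro p _ z
    simp only [hNbdef, Finset.mem_filter]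
    constructor
    · exact fun h => h.2
    · intro h
      exact ⟨Finset.mem_coe.1 (hK.mem_of_mem h.2 (by simp)), h⟩
  set S : EuclideanSpace ℝ (Fin 3) → EuclideanSpace ℝ (Fin 3) → Finset (Finset (EuclideanSpace ℝ (Fin 3))) :=
    fun p z => hfin.toFinset.filter fun t => p ∈ t ∧ z ∈ t ∧ t.card = 4 with hSdef
  have hS : ∀ p ∈ P, ∀ z ∈ Nb p, ∀ t, t ∈ S p z ↔ t ∈ K.faces ∧ p ∈ t ∧ z ∈ t ∧ t.card = 4 := by
    intro p _ z _ t
    simp only [hSdef, Finset.mem_filter, Set.Finite.mem_toFinset]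
  have hG := ParFiveRecountTetGauge.stub_tetGauge ρ ω P hPω hPint K hK.toIsTriangulation Nb hNb S hS Cells hCells
  rw [← hG, residual_eq_sum_close hd hρ ω P hPω hωsep hghost hPint K hK Nb hNb S hS]
  have hsepP : ∀ p ∈ P, ∀ q ∈ P, p ≠ q → d ≤ dist p q :=
    fun p hp q hq hpq => hωsep p (hPω hp) q (hPω hq) hpq
  exact_mod_cast sum_close_le_of_crux hA hd hρ P hsepP

end Summit.AtomisticToContinuum.Crystallization.Theorems.ParFiveRecountConverse

end
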